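import Summits.KontsevichZagierPeriods.KontsevichZagierPeriods.Theses.FurushoPentagon
import Summits.KontsevichZagierPeriods.KontsevichZagierPeriods.Theorems.FurushoPentagonReducedPeriodRingLinStokesSymDefs
import Summits.KontsevichZagierPeriods.KontsevichZagierPeriods.Theorems.FurushoPentagonReducedPeriodRingSubdivGeneration
import Summits.KontsevichZagierPeriods.KontsevichZagierPeriods.Theorems.FurushoPentagonReducedPeriodRingReflectionGeneration
import Summits.KontsevichZagierPeriods.KontsevichZagierPeriods.Theorems.FurushoPentagonLinStokesSymCovDet
import Summits.KontsevichZagierPeriods.KontsevichZagierPeriods.Theorems.FurushoPentagonLinStokesSymCovHomotopy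
import Summits.KontsevichZagierPeriods.KontsevichZagierPeriods.Theorems.FurushoPentagonLinStokesSymCovClosed
import Summits.KontsevichZagierPeriods.KontsevichZagierPeriods.Theorems.FurushoPentagonLinStokesSymCovFace
import Summits.KontsevichZagierPeriods.KontsevichZagierPeriods.Theorems.FurushoPentagonSectorToKernelStokesSpanCalibration
import Literature.NumberTheory.Transcendental.KZCubicalCalculus
import Literature.NumberTheory.Transcendental.KZProductIdeal
import Literature.NumberTheory.Transcendental.SemialgebraicMapsProofs
import Literature.NumberTheory.Transcendental.SemialgebraicLineDeriv
import Mathlib.LinearAlgebra.Matrix.Adjugate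
import Mathlib.MeasureTheory.Function.Jacobian
import Mathlib.MeasureTheory.Measure.OpenPos
import Mathlib.Analysis.Calculus.TangentCone.Pi

/-!
# `ReducedPeriodRing`, line `lin-stokes-sym`: cubical changes of variables, reduction to the face structure

Helper file for the stub `stub_covGeneration` of crux `FurushoPentagon.ReducedPeriodRing`
(stmt-KontsevichZagierPeriods-3929), line `lin-stokes-sym` (registered sub-goal
`stub_covGeneration_reduction`): every change-of-variables generator `[r] − [r']` of the cubical
Kontsevich–Zagier calculus (`KZ.cubicalCovGens`: tame cubes `r, r'` on `[0,1]ⁿ`, a map `Φ` with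
coordinates analytic near the cube and `ℚ`-semialgebraic on it, injective on the cube, onto the
cube, with `r = r'(Φ)·|det Φ'|`) lies in Ayoub's relation module with symmetries
`linStokesSymIdeal = closure (Lin ∪ StokesLast ∪ Sym)`, GIVEN the face structure of such maps
(`covGeneration_of_factorisation`): an analytic injective self-map of the cube onto the cube maps
the facet `{x_j = 0}` into a facet `{u_{σ j} = ε_j}` and the opposite facet into the opposite one.

Proof. (1) Normalise by the hyperoctahedral symmetry `h(u)_j = 1 − u_{σ j}` (`ε_j`) resp. `u_{σ j}`:
`Ψ = h ∘ Φ` preserves every facet, and `r'(Φ x) = f(Ψ x)` with `f = r' ∘ h⁻¹` a tame cube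
congruent to `r'` (`CovGeneration.of_sub_of_mem_of_hyperoctahedral`, one symmetry generator and one
reflection per flipped coordinate). (2) `|det Ψ'| = |det Φ'|` (`|det h| = 1`) and
`det Ψ' ≥ 0` on the cube (`det_fderiv_nonneg_of_facePreserving`): the face-preserving homotopy
formula with `f = 1` and the SOUNDNESS of the calculus give `∫_{[0,1]ⁿ} det Ψ' = 1`, while the
change-of-variables inequality gives `∫_{[0,1]ⁿ} |det Ψ'| = vol Ψ([0,1]ⁿ) ≤ 1`; so the continuous
function `|det Ψ'| − det Ψ' ≥ 0` has integral `≤ 0` on the cube and vanishes there. Hence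
`r = f(Ψ)·det Ψ'` on the cube. (3) The face-preserving change of variables
`[f(Ψ) det Ψ'] − [f] ∈ linStokesSymIdeal` is `CovGeneration.of_sub_of_mem_of_facePreserving`
(straight-line homotopy `φ = (1 − y)x + yΨ(x)`, closedness of the pulled-back volume form
`∂_y B = Σⱼ ∂ⱼ A_j`, Newton–Leibniz along `y` and along each `x_j` after a coordinate symmetry,
with vanishing boundary values on the facets; files `…LinStokesSymCovDet`, `…CovHomotopy`,
`…CovClosed`, `…CovFace`).

References: M. Kontsevich, D. Zagier, *Periods* (2001), §1.2 rules (1)–(3); J. Ayoub, *Periods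
and the conjectures of Grothendieck and Kontsevich–Zagier*, EMS Newsl. 91 (2014), Def. 10;
J. Bochnak, M. Coste, M.-F. Roy, *Real Algebraic Geometry* (1998), Prop. 2.2.6.
-/

noncomputable section

namespace Summit.KontsevichZagierPeriods.FurushoPentagon.ReducedPeriodRing.LinStokesSym

open Set MeasureTheory
open Literature.NumberTheory.Transcendental
open Literature.NumberTheory.Transcendental.KZ
open Summit.KontsevichZagierPeriods.FurushoPentagon.SectorToKernel

namespace CovGeneration

open SubdivGeneration (analyticOnNhd_apply isTameCube_reindex analyticOnNhd_comp_perm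
  isSemialgebraicFunOn_comp_perm)

/-! ### Orientation -/

/-- Derivatives within the closed cube are unique. [folklore] -/
theorem uniqueDiffOn_cube (n : ℕ) : UniqueDiffOn ℝ (cube n) := by
  rw [cube_eq_pi]
  exact UniqueDiffOn.univ_pi fun _ => uniqueDiffOn_Icc zero_lt_one

/-- **Face-preserving injective analytic self-maps of the cube are orientation-preserving:
`det DΨ ≥ 0` on the cube.** The homotopy formula with `f = 1`
(`of_sub_of_mem_of_facePreserving`) and the soundness of the Kontsevich–Zagier calculus give
`∫_{[0,1]ⁿ} det DΨ = ∫_{[0,1]ⁿ} 1 = 1`; the change-of-variables inequality gives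
`∫_{[0,1]ⁿ} |det DΨ| = vol Ψ([0,1]ⁿ) ≤ 1`; so the continuous non-negative function
`|det DΨ| − det DΨ` has integral `≤ 0` on the cube, hence vanishes on it (the cube is the closure
of its interior). [folklore] -/
theorem det_fderiv_nonneg_of_facePreserving {n : ℕ} {Ψ : (Fin n → ℝ) → (Fin n → ℝ)}
    (hΨa : ∀ i, AnalyticOnNhd ℝ (fun x => Ψ x i) (cube n))
    (hΨs : ∀ i, IsSemialgebraicFunOn ℚ (cube n) (fun x => Ψ x i))
    (hΨm : MapsTo Ψ (cube n) (cube n)) (hinj : InjOn Ψ (cube n))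
    (hface0 : ∀ x ∈ cube n, ∀ j, x j = 0 → Ψ x j = 0)
    (hface1 : ∀ x ∈ cube n, ∀ j, x j = 1 → Ψ x j = 1) {x : Fin n → ℝ} (hx : x ∈ cube n) :
    0 ≤ (fderiv ℝ Ψ x).det := by
  -- `D = det DΨ` in matrix form is a tame function with `D = det (fderiv Ψ)` on the cube
  have hDa : AnalyticOnNhd ℝ (fun x => (Matrix.of fun i k : Fin n =>
      fderiv ℝ (fun z => Ψ z i) x (Pi.single k 1)).det) (cube n) :=
    analyticOnNhd_matrix_det fun i k => stokesCal_analyticOnNhd_fderiv_apply (hΨa i) _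
  have hDs : IsSemialgebraicFunOn ℚ (cube n) (fun x => (Matrix.of fun i k : Fin n =>
      fderiv ℝ (fun z => Ψ z i) x (Pi.single k 1)).det) :=
    IsSemialgebraicFunOn.matrix_det isSemialgebraic_cube fun i k =>
      isSemialgebraicFunOn_fderiv_apply_single (hΨa i) (hΨs i) k
  have hΨd : ∀ x ∈ cube n, ∀ i, DifferentiableAt ℝ (fun z => Ψ z i) x :=
    fun x hx i => (hΨa i x hx).differentiableAt
  have hDeq : ∀ x ∈ cube n, (Matrix.of fun i k : Fin n =>
      fderiv ℝ (fun z => Ψ z i) x (Pi.single k 1)).det = (fderiv ℝ Ψ x).det :=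
    fun x hx => det_of_fderiv_comp_apply (hΨd x hx)
  have h1s : IsSemialgebraicFunOn ℚ (cube n) (fun _ : Fin n → ℝ => (1 : ℝ)) := by
    simpa using isSemialgebraicFunOn_ratCast (isSemialgebraic_cube (n := n)) 1
  have hmem : of (IntegralRep.tameCube _ hDa hDs) -
      of (IntegralRep.tameCube _ analyticOnNhd_const h1s) ∈ linStokesSymIdeal :=
    of_sub_of_mem_of_facePreserving hΨa hΨs hΨm hface0 hface1
      (IntegralRep.isTameCube_tameCube _ hDa hDs)
      (IntegralRep.isTameCube_tameCube _ analyticOnNhd_const h1s) fun x hx => by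
        simp only [IntegralRep.tameCube_integrand, hDeq x hx, one_mul]
  -- soundness: `∫_cube D = ∫_cube 1 = 1`
  have hI1 : ∫ x in cube n, (Matrix.of fun i k : Fin n =>
      fderiv ℝ (fun z => Ψ z i) x (Pi.single k 1)).det = 1 := by
    have h := Equivalent.value_eq_holds (linStokesSymIdeal_le_relations hmem)
    simp only [IntegralRep.value_tameCube] at h
    rw [h, setIntegral_const, volume_real_cube, one_smul]
  -- change of variables: `∫_cube |det DΨ| = vol (Ψ '' cube) ≤ 1`
  have hI2 : ∫ x in cube n, |(Matrix.of fun i k : Fin n =>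
      fderiv ℝ (fun z => Ψ z i) x (Pi.single k 1)).det| ≤ 1 := by
    have hcov := integral_image_eq_integral_abs_det_fderiv_smul volume measurableSet_cube
      (fun x hx => ((differentiableAt_pi.2 (hΨd x hx)).hasFDerivAt).hasFDerivWithinAt) hinj
      (fun _ => (1 : ℝ))
    have hcongr : ∫ x in cube n, |(Matrix.of fun i k : Fin n =>
        fderiv ℝ (fun z => Ψ z i) x (Pi.single k 1)).det| = ∫ x in cube n, |(fderiv ℝ Ψ x).det| :=
      setIntegral_congr_fun measurableSet_cube fun x hx => by rw [hDeq x hx]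
    simp only [smul_eq_mul, mul_one] at hcov
    rw [hcongr, ← hcov, setIntegral_const, smul_eq_mul, mul_one]
    calc volume.real (Ψ '' cube n) ≤ volume.real (cube n) :=
          measureReal_mono hΨm.image_subset (by simp)
      _ = 1 := volume_real_cube
  -- so `|D| − D ≥ 0`, continuous on the cube with integral `≤ 0`, vanishes on the cube
  have hgc : ContinuousOn (fun x => |(Matrix.of fun i k : Fin n =>
      fderiv ℝ (fun z => Ψ z i) x (Pi.single k 1)).det| - (Matrix.of fun i k : Fin n =>
      fderiv ℝ (fun z => Ψ z i) x (Pi.single k 1)).det) (cube n) :=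
    hDa.continuousOn.abs.sub hDa.continuousOn
  have hg0 : ∀ x, 0 ≤ |(Matrix.of fun i k : Fin n =>
      fderiv ℝ (fun z => Ψ z i) x (Pi.single k 1)).det| - (Matrix.of fun i k : Fin n =>
      fderiv ℝ (fun z => Ψ z i) x (Pi.single k 1)).det :=
    fun x => sub_nonneg.2 (le_abs_self _)
  have hgi := hgc.integrableOn_compact (μ := volume) isCompact_cube
  have hint : ∫ x in cube n, (|(Matrix.of fun i k : Fin n =>
      fderiv ℝ (fun z => Ψ z i) x (Pi.single k 1)).det| - (Matrix.of fun i k : Fin n =>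
      fderiv ℝ (fun z => Ψ z i) x (Pi.single k 1)).det) = 0 := by
    refine le_antisymm ?_ (setIntegral_nonneg measurableSet_cube fun x _ => hg0 x)
    rw [integral_sub (hDa.continuousOn.abs.integrableOn_compact isCompact_cube)
      (hDa.continuousOn.integrableOn_compact isCompact_cube), hI1]
    linarith [hI2]
  have hae := (setIntegral_eq_zero_iff_of_nonneg_ae (Filter.Eventually.of_forall hg0) hgi).1 hint
  -- the closed cube is the closure of its interior
  -- (cf. `UnfoldedStokes.ContinuousCubificationNegative.cube_subset_closure_interior`)
  have hcl : cube n ⊆ closure (interior (cube n)) := by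
    intro z hz
    rw [cube_eq_pi, interior_pi_set finite_univ, closure_pi_set, mem_univ_pi]
    intro i
    rw [interior_Icc, closure_Ioo (zero_ne_one' ℝ)]
    exact ⟨(hz i).1, (hz i).2⟩
  have hEq := Measure.eqOn_of_ae_eq hae hgc continuousOn_const hcl hx
  simp only [Pi.zero_apply, sub_eq_zero] at hEq
  rw [← hDeq x hx, ← hEq]
  exact abs_nonneg _

/-! ### The hyperoctahedral normalisation -/

/-- The linear part `L(u)_j = ∓u_{σ j}` of the hyperoctahedral map `h(u)_j = 1 − u_{σ j}` (`ε_j`)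
resp. `u_{σ j}` has `|det L| = 1` (a signed permutation matrix). [folklore] -/
theorem abs_det_signedPerm {n : ℕ} (σ : Equiv.Perm (Fin n)) (ε : Fin n → Bool) :
    |(ContinuousLinearMap.pi fun j : Fin n => (if ε j then (-1 : ℝ) else 1) •
      (ContinuousLinearMap.proj (σ j) : (Fin n → ℝ) →L[ℝ] ℝ)).det| = 1 := by
  set L : (Fin n → ℝ) →L[ℝ] (Fin n → ℝ) := ContinuousLinearMap.pi fun j : Fin n =>
    (if ε j then (-1 : ℝ) else 1) • (ContinuousLinearMap.proj (σ j) : (Fin n → ℝ) →L[ℝ] ℝ) with hL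
  have hmat : LinearMap.toMatrix' (L : (Fin n → ℝ) →ₗ[ℝ] (Fin n → ℝ)) =
      Matrix.diagonal (fun j => if ε j then (-1 : ℝ) else 1) *
        (1 : Matrix (Fin n) (Fin n) ℝ).submatrix σ (Equiv.refl _) := by
    ext j m
    rw [LinearMap.toMatrix'_apply, Matrix.diagonal_mul, Matrix.submatrix_apply, Matrix.one_apply]
    by_cases hj : ε j <;> by_cases hjm : σ j = m <;> simp [hL, hj, hjm]
  have hdet : L.det = LinearMap.det (L : (Fin n → ℝ) →ₗ[ℝ] (Fin n → ℝ)) := rfl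
  rw [hdet, ← LinearMap.det_toMatrix', hmat, Matrix.det_mul, abs_mul,
    Matrix.abs_det_submatrix_equiv_equiv, Matrix.det_one, abs_one, mul_one, Matrix.det_diagonal,
    Finset.abs_prod]
  exact Finset.prod_eq_one fun j _ => by by_cases hj : ε j <;> simp [hj]

/-- The hyperoctahedral normalisation `Ψ(x)_j = 1 − Φ(x)_{σ j}` (`ε_j`) resp. `Φ(x)_{σ j}` has
derivative `L ∘ Φ'` within any set where `Φ` has derivative `Φ'`. [folklore] -/
theorem hasFDerivWithinAt_normalisation {n : ℕ} (σ : Equiv.Perm (Fin n)) (ε : Fin n → Bool)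
    {Φ : (Fin n → ℝ) → (Fin n → ℝ)} {Φ'x : (Fin n → ℝ) →L[ℝ] (Fin n → ℝ)} {s : Set (Fin n → ℝ)}
    {x : Fin n → ℝ} (h : HasFDerivWithinAt Φ Φ'x s x) :
    HasFDerivWithinAt (fun x j => if ε j then 1 - Φ x (σ j) else Φ x (σ j))
      ((ContinuousLinearMap.pi fun j : Fin n => (if ε j then (-1 : ℝ) else 1) •
        (ContinuousLinearMap.proj (σ j) : (Fin n → ℝ) →L[ℝ] ℝ)).comp Φ'x) s x := by
  have hfun : (fun x j => if ε j then 1 - Φ x (σ j) else Φ x (σ j)) = fun x =>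
      (fun j => if ε j then (1 : ℝ) else 0) +
        (ContinuousLinearMap.pi fun j : Fin n => (if ε j then (-1 : ℝ) else 1) •
          (ContinuousLinearMap.proj (σ j) : (Fin n → ℝ) →L[ℝ] ℝ)) (Φ x) := by
    funext x; funext j
    simp only [Pi.add_apply, ContinuousLinearMap.pi_apply, FunLike.coe_smul,
      Pi.smul_apply, ContinuousLinearMap.proj_apply, smul_eq_mul]
    by_cases hj : ε j
    · simp only [hj, if_true]; ring
    · simp only [hj, Bool.false_eq_true, if_false]; ring
  rw [hfun]
  exact ((ContinuousLinearMap.hasFDerivAt _).comp_hasFDerivWithinAt x h).const_add _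

/-! ### The change-of-variables generators, given the face structure -/

/-- **Cubical changes of variables from Lin + StokesLast + Sym, given the face structure of
analytic injective self-maps of the cube.** If every such map sends the facet `{x_j = 0}` into a
facet `{u_{σ j} = ε_j}` and the opposite facet into the opposite one, then
`KZ.cubicalCovGens ⊆ linStokesSymIdeal`: normalise by the hyperoctahedral symmetry
(`of_sub_of_mem_of_hyperoctahedral`), identify `|det Φ'|` with `det DΨ`
(`det_fderiv_nonneg_of_facePreserving`, `abs_det_signedPerm`), and apply the face-preserving
change of variables (`of_sub_of_mem_of_facePreserving`).
[Kontsevich–Zagier 2001, §1.2 rules (1)–(3); Ayoub 2014, Def. 10] -/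
theorem covGeneration_of_factorisation
    (hfact : ∀ (n : ℕ) (Φ : (Fin n → ℝ) → (Fin n → ℝ)), ContinuousOn Φ (cube n) →
      Set.InjOn Φ (cube n) → Φ '' cube n = cube n →
      (∀ i : Fin n, AnalyticOnNhd ℝ (fun x => Φ x i) (cube n)) →
      ∃ (σ : Equiv.Perm (Fin n)) (ε : Fin n → Bool), ∀ x ∈ cube n, ∀ j : Fin n,
        (x j = 0 → Φ x (σ j) = (if ε j then 1 else 0)) ∧
        (x j = 1 → Φ x (σ j) = (if ε j then 0 else 1))) :
    KZ.cubicalCovGens ⊆ (linStokesSymIdeal : Set FormalRep) := by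
  rintro c ⟨n, r, r', Φ, Φ', hr, hra, hr', hr'a, hΦs, hΦ', hinj, himg, hΦa, hf, rfl⟩
  have hΦc : ContinuousOn Φ (cube n) := continuousOn_pi.2 fun i => (hΦa i).continuousOn
  obtain ⟨σ, ε, hσε⟩ := hfact n Φ hΦc hinj himg hΦa
  have hΦsi : ∀ i, IsSemialgebraicFunOn ℚ (cube n) (fun x => Φ x i) :=
    (isSemialgebraicMapOn_iff_forall_holds (k := ℚ) isSemialgebraic_cube).1 hΦs
  have hΦm : MapsTo Φ (cube n) (cube n) := fun x hx => himg ▸ mem_image_of_mem Φ hx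
  -- the normalisation `Ψ = h ∘ Φ`
  obtain ⟨Ψ, hΨ⟩ : ∃ Ψ : (Fin n → ℝ) → (Fin n → ℝ),
      Ψ = fun x j => if ε j then 1 - Φ x (σ j) else Φ x (σ j) := ⟨_, rfl⟩
  have hΨa : ∀ j, AnalyticOnNhd ℝ (fun x => Ψ x j) (cube n) := by
    intro j
    by_cases hj : ε j
    · simp only [hΨ, hj, if_true]; exact analyticOnNhd_const.sub (hΦa (σ j))
    · simp only [hΨ, hj, Bool.false_eq_true, if_false]; exact hΦa (σ j)
  have h1s : IsSemialgebraicFunOn ℚ (cube n) (fun _ : Fin n → ℝ => (1 : ℝ)) := by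
    simpa using isSemialgebraicFunOn_ratCast (isSemialgebraic_cube (n := n)) 1
  have hΨs : ∀ j, IsSemialgebraicFunOn ℚ (cube n) (fun x => Ψ x j) := by
    intro j
    by_cases hj : ε j
    · simp only [hΨ, hj, if_true]; exact h1s.fun_sub (hΦsi (σ j))
    · simp only [hΨ, hj, Bool.false_eq_true, if_false]; exact hΦsi (σ j)
  have hΨm : MapsTo Ψ (cube n) (cube n) := by
    intro x hx j
    have h := hΦm hx (σ j)
    by_cases hj : ε j
    · simp only [hΨ, hj, if_true]; exact ⟨by linarith [h.2], by linarith [h.1]⟩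
    · simp only [hΨ, hj, Bool.false_eq_true, if_false]; exact h
  have hΨ0 : ∀ x ∈ cube n, ∀ j, x j = 0 → Ψ x j = 0 := by
    intro x hx j hxj
    have h := (hσε x hx j).1 hxj
    by_cases hj : ε j
    · simp only [hj, if_true] at h
      simp only [hΨ, hj, if_true, h]; ring
    · simp only [hj, Bool.false_eq_true, if_false] at h
      simp only [hΨ, hj, Bool.false_eq_true, if_false, h]
  have hΨ1 : ∀ x ∈ cube n, ∀ j, x j = 1 → Ψ x j = 1 := by
    intro x hx j hxj
    have h := (hσε x hx j).2 hxj
    by_cases hj : ε j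
    · simp only [hj, if_true] at h
      simp only [hΨ, hj, if_true, h]; ring
    · simp only [hj, Bool.false_eq_true, if_false] at h
      simp only [hΨ, hj, Bool.false_eq_true, if_false, h]
  have hΨinj : InjOn Ψ (cube n) := by
    intro x hx x' hx' hxx'
    refine hinj hx hx' (funext fun m => ?_)
    have h := congr_fun hxx' (σ.symm m)
    by_cases hj : ε (σ.symm m)
    · simp only [hΨ, hj, if_true, Equiv.apply_symm_apply] at h; linarith
    · simpa only [hΨ, hj, Bool.false_eq_true, if_false, Equiv.apply_symm_apply] using h
  -- derivatives: `fderiv Ψ = L ∘ Φ'` on the cube, `|det L| = 1`, `det (fderiv Ψ) ≥ 0`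
  obtain ⟨L, hL⟩ : ∃ L : (Fin n → ℝ) →L[ℝ] (Fin n → ℝ), L = ContinuousLinearMap.pi fun j : Fin n =>
      (if ε j then (-1 : ℝ) else 1) • (ContinuousLinearMap.proj (σ j) : (Fin n → ℝ) →L[ℝ] ℝ) :=
    ⟨_, rfl⟩
  have hLdet : |L.det| = 1 := by rw [hL]; exact abs_det_signedPerm σ ε
  have hdet : ∀ x ∈ cube n, (fderiv ℝ Ψ x).det = |(Φ' x).det| := by
    intro x hx
    have hΨd : DifferentiableAt ℝ Ψ x := differentiableAt_pi.2 fun j => (hΨa j x hx).differentiableAt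
    have hΨ' := hasFDerivWithinAt_normalisation σ ε (hΦ' x hx)
    rw [← hΨ, ← hL] at hΨ'
    have huniq := (uniqueDiffOn_cube n x hx).eq hΨd.hasFDerivAt.hasFDerivWithinAt hΨ'
    have hnn := det_fderiv_nonneg_of_facePreserving hΨa hΨs hΨm hΨinj hΨ0 hΨ1 hx
    have hcomp : (L.comp (Φ' x)).det = L.det * (Φ' x).det := LinearMap.det_comp _ _
    rw [← abs_of_nonneg hnn, huniq, hcomp, abs_mul, hLdet, one_mul]
  -- `f = r' ∘ h⁻¹`, a tame cube congruent to `r'`, with `r'(Φ x) = f(Ψ x)`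
  obtain ⟨T, hT⟩ : ∃ T : Finset (Fin n), ∀ m, m ∈ T ↔ ε (σ.symm m) = true :=
    ⟨Finset.univ.filter fun m => ε (σ.symm m) = true, fun m => by simp⟩
  have hr't : r'.IsTameCube := ⟨hr', hr'a⟩
  obtain ⟨-, hga, hgs⟩ := reflect_sideConditions T hr'a hr't.isSemialgebraicFunOn
  obtain ⟨f, hfd⟩ : ∃ f : (Fin n → ℝ) → ℝ, f = fun z =>
      r'.integrand (fun m => if m ∈ T then 1 - z (σ.symm m) else z (σ.symm m)) := ⟨_, rfl⟩
  have hfa : AnalyticOnNhd ℝ f (cube n) := by rw [hfd]; exact analyticOnNhd_comp_perm hga σ.symm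
  have hfs : IsSemialgebraicFunOn ℚ (cube n) f := by
    rw [hfd]; exact isSemialgebraicFunOn_comp_perm hgs σ.symm
  have hfΨ : ∀ x, f (Ψ x) = r'.integrand (Φ x) := by
    intro x
    simp only [hfd, hΨ, Equiv.apply_symm_apply]
    congr 1
    funext m
    by_cases hm : ε (σ.symm m)
    · simp only [(hT m).2 hm, hm, if_true]; ring
    · have hm' : m ∉ T := fun h' => hm ((hT m).1 h')
      simp only [hm', hm, Bool.false_eq_true, if_false]
  have hft : (IntegralRep.tameCube f hfa hfs).IsTameCube := IntegralRep.isTameCube_tameCube f hfa hfs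
  -- (3) face-preserving change of variables `[r] − [f]`, and (1) `[f] − [r']`
  have hC : of r - of (IntegralRep.tameCube f hfa hfs) ∈ linStokesSymIdeal :=
    of_sub_of_mem_of_facePreserving hΨa hΨs hΨm hΨ0 hΨ1 ⟨hr, hra⟩ hft fun x hx => by
      rw [hf x hx, IntegralRep.tameCube_integrand, hfΨ x, hdet x hx]
  have hB : of (IntegralRep.tameCube f hfa hfs) - of r' ∈ linStokesSymIdeal :=
    of_sub_of_mem_of_hyperoctahedral σ.symm (fun m => m ∈ T) hft hr't fun x _ => by
      rw [IntegralRep.tameCube_integrand, hfd]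
  have hCB := linStokesSymIdeal.add_mem hC hB
  rw [sub_add_sub_cancel] at hCB
  exact hCB

end CovGeneration

/-- **Registered sub-goal `stub_covGeneration_reduction`** of crux stmt-KontsevichZagierPeriods-3929
(serving `stub_covGeneration` of line `lin-stokes-sym`): the change-of-variables generators of the
cubical calculus lie in `linStokesSymIdeal` as soon as analytic injective self-maps of the cube
onto the cube have the hyperoctahedral face structure
(`CovGeneration.covGeneration_of_factorisation`).
[Kontsevich–Zagier 2001, §1.2 rules (1)–(3); Ayoub 2014, Def. 10] -/
theorem stub_covGeneration_reduction : (∀ (n : ℕ) (Φ : (Fin n → ℝ) → (Fin n → ℝ)), ContinuousOn Φ (KZ.cube n) → Set.InjOn Φ (KZ.cube n) → Φ '' KZ.cube n = KZ.cube n → (∀ i : Fin n, AnalyticOnNhd ℝ (fun x => Φ x i) (KZ.cube n)) → ∃ (σ : Equiv.Perm (Fin n)) (ε : Fin n → Bool), ∀ x ∈ KZ.cube n, ∀ j : Fin n, (x j = 0 → Φ x (σ j) = (if ε j then 1 else 0)) ∧ (x j = 1 → Φ x (σ j) = (if ε j then 0 else 1))) → KZ.cubicalCovGens ⊆ (linStokesSymIdeal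 : Set FormalRep) :=
  CovGeneration.covGeneration_of_factorisation

end Summit.KontsevichZagierPeriods.FurushoPentagon.ReducedPeriodRing.LinStokesSym
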